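import Summits.NavierStokesRegularity.FunctionalMining.ThreeWaveStrain
import Summits.NavierStokesRegularity.FunctionalMining.StretchingConst
import HarnessLib

/-!
# K1-Q1 lower side in the kernel: `√6/24 ≤ C⋆` from the three-wave field

NS FUNCTIONAL MINING cell (`pub-nsfunc`), dictionary seat — **search for candidate a priori
estimates; no regularity claim.** Nothing here asserts anything about Navier–Stokes regularity.

`C⋆ = stretchingSupConst` is the best constant in the STATIC sup-stretching inequality
`∫⟪(v·∇)v, Δv⟫ ≤ C·‖ω‖_∞·ℰ(v)` (`StretchingSupBound`, K0 row K1-Q1; `ℰ = ½∫|∇v|²`); the tree knows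
`C⋆ ≤ 2/√3` (`stretchingSupConst_le_holder`, Hölder) and `StretchingSupBound C⋆`. This file records the
first KERNEL lower bound, read off the tree's three-wave field `w = ThreeWaveTorus.w` (p195100):
production `16π³` (`enstrophyProduction_threeWave`, tree), enstrophy `ℰ(w) = 16π²` (Parseval,
`torusEnstrophy_w` below), and `|ω(x)|² ≤ 96π²` pointwise (`MiddleEigenKill.vorticitySq_le_w`, part 1 of
the K1-Q2 kernel instance), so `M = 4√6·π` is admissible and `StretchingSupBound C` forces
`16π³ ≤ C·4√6π·16π²`, i.e. `C ≥ 1/(4√6) = √6/24 ≈ 0.102`. Hence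

* `not_stretchingSupBound_of_lt_sqrt_six_div : C < √6/24 → ¬ StretchingSupBound C`,
* `sqrt_six_div_le_stretchingSupConst : √6/24 ≤ stretchingSupConst`, so the kernel window is
  `√6/24 ≤ C⋆ ≤ 2/√3`;
* the generic recording lemma `le_stretchingSupConst_of_forall_lt` (`(∀ C < K, ¬ StretchingSupBound C)
  → K ≤ C⋆`), through which sharper witnesses enter by one line: the bank seat's planar 8-mode field
  gives `√3/9 ≈ 0.192` (hand SOS proof, `pub-nsfunc-bank/K1Q1-LOWER.md` §1) and its `(n, τ)` family
  `√(71 − 17√17)/4 ≈ 0.238` (§1b) — NOT kernel-checked here; certified-numerics rows reach `0.3299`.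

A weak rung, deliberately: it costs nothing beyond the K1-Q2 part 1 and puts a kernel number on the
lower side of K1-Q1. Search for candidate a priori estimates; no regularity claim.
-/

noncomputable section

open Set MeasureTheory Complex Finset
open scoped RealInnerProductSpace ComplexConjugate

namespace Summit.NavierStokesRegularity.FunctionalMining

open Literature.Analysis Literature.Analysis.FunctionSpaces Literature.Analysis.FunctionSpaces.Torus
open Literature.Analysis.FluidPDE UnitAddTorus ThreeWaveTorus

variable {d : Type*} [Fintype d] [DecidableEq d]

/-- **Recording lemma**: if `StretchingSupBound C` fails for every `C < K` then `K ≤ C⋆`. [ours; elementary] -/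
theorem le_stretchingSupConst_of_forall_lt {K : ℝ}
    (h : ∀ C : ℝ, C < K → ¬ StretchingSupBound (d := d) C) :
    K ≤ stretchingSupConst (d := d) := by
  by_contra hlt
  obtain ⟨C, hC1, hC2⟩ := exists_between (lt_of_not_ge hlt)
  exact absurd (le_stretchingSupConst (h C hC2)) (not_le.2 hC1)

namespace MiddleEigenKill

/-- `‖∇w‖²_{L²} = 32π²` for the three-wave field (Parseval: `4π² Σ_{k∈S} |k|²‖ĉ(k)‖² = 4π²·8`).
[ours; elementary] -/
theorem gradNormSq_w : Torus.gradNormSq w = 32 * Real.pi ^ 2 := by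
  obtain ⟨h1, h1', h2, h2', h12, h12'⟩ := freqNormSq_table
  rw [show w = realTrigPoly S c from rfl, gradNormSq_eq_toReal_eGradNormSq_holds (isSmooth_realTrigPoly S c),
    toReal_eGradNormSq_realTrigPoly neg_mem_S isConjSymm_c, sum_S]
  simp only [c_e1, c_neg_e1, c_e2, c_neg_e2, c_e12, c_neg_e12, h1, h1', h2, h2', h12, h12']
  simp [EuclideanSpace.norm_eq, Fin.sum_univ_three]
  ring

/-- `ℰ(w) = ½‖∇w‖² = 16π²`. [ours; elementary] -/
theorem torusEnstrophy_w : torusEnstrophy w = 16 * Real.pi ^ 2 := by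
  rw [torusEnstrophy, gradNormSq_w]; ring

/-- `|ω(x)|² ≤ (4√6·π)²` pointwise (`= 96π²`, part 1). [ours; elementary] -/
theorem torusVorticitySqAt_w_le (x : UnitAddTorus (Fin 3)) :
    torusVorticitySqAt w x ≤ (4 * Real.sqrt 6 * Real.pi) ^ 2 := by
  rw [torusVorticitySqAt_w, show (4 * Real.sqrt 6 * Real.pi) ^ 2 = 96 * Real.pi ^ 2 by
    rw [mul_pow, mul_pow, Real.sq_sqrt (by norm_num : (0:ℝ) ≤ 6)]; ring]
  exact vorticitySq_le_w x

/-- **K1-Q1, kernel lower side: `StretchingSupBound C` fails for every `C < √6/24 = 1/(4√6) ≈ 0.102`**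
(three-wave field: `16π³ ≤ C·4√6π·16π²` is false). Search for candidate a priori estimates; no
regularity claim. [ours] -/
theorem not_stretchingSupBound_of_lt_sqrt_six_div {C : ℝ} (hC : C < Real.sqrt 6 / 24) :
    ¬ StretchingSupBound (d := Fin 3) C := by
  intro h
  have hle := h (Fintype.card_fin 3) w isSmooth_w isDivFree_w (4 * Real.sqrt 6 * Real.pi)
    (by positivity) torusVorticitySqAt_w_le
  rw [enstrophyProduction_threeWave, torusEnstrophy_w] at hle
  -- `hle : 16π³ ≤ C * (4√6π) * (16π²)`, i.e. `1 ≤ 4√6·C`, false for `C < √6/24` (`4√6·√6/24 = 1`)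
  have h6 : Real.sqrt 6 * Real.sqrt 6 = 6 := Real.mul_self_sqrt (by norm_num)
  have hs : 0 < Real.sqrt 6 := by positivity
  have hpi := Real.pi_pos
  have h3 : 0 < Real.pi ^ 3 := by positivity
  have key : 16 * Real.pi ^ 3 * (1 - 4 * Real.sqrt 6 * C) ≤ 0 := by nlinarith [hle]
  have h1 : 1 - 4 * Real.sqrt 6 * C ≤ 0 := by
    by_contra hcon
    have := mul_pos (by positivity : (0:ℝ) < 16 * Real.pi ^ 3) (lt_of_not_ge hcon)
    linarith
  nlinarith [mul_lt_mul_of_pos_left hC (by positivity : (0:ℝ) < 4 * Real.sqrt 6)]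

/-- **`√6/24 ≤ C⋆`**: the kernel window for the sharp sup-stretching constant is
`√6/24 ≈ 0.102 ≤ C⋆ ≤ 2/√3 ≈ 1.155` (upper side: `stretchingSupConst_le_holder`). Search for candidate
a priori estimates; no regularity claim. [ours] -/
theorem sqrt_six_div_le_stretchingSupConst :
    Real.sqrt 6 / 24 ≤ stretchingSupConst (d := Fin 3) :=
  le_stretchingSupConst_of_forall_lt fun _ hC => not_stretchingSupBound_of_lt_sqrt_six_div hC

end MiddleEigenKill

end Summit.NavierStokesRegularity.FunctionalMining

end
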